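/-
Copyright (c) 2026 the pub-hodgecm-mathlib formalisation cell (harness21).  Prover seat hodgecm-mathlib-K2E4-p11 (g9): Track B «K2-LIT»,
hLiu418 = stmt-HodgeConjecture-24832, socket #41 KIND W, organ «Φ6b-ind» (R3) growth, FILE G1 (KW desk F0P2-p08 (g4) 01:26:19Z «(R3) census GO»):
THE ξ-INTEGRAND CONTINUED INTO THE STRIP `|im a| < 1` OF THE FIRST CHART COORDINATE — the two diagonal «g»'s it produces, their comparison, and the
uniform majorant.  THEOREMS ONLY (no `def`, no `instance`, no `notation`, no named-fact hypothesis, no `sorry`).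
-/
import Summits.HodgeConjecture.HodgeConjecture.Theorems.K2LiuHermTwoXiCayleyIntegrability     -- ★ FILE 3a (this seat): `norm_entry_le_mul_norm_det_hermTwo`
import Summits.HodgeConjecture.HodgeConjecture.Theorems.K2LiuHermTwoConfluentXiRegularity      -- ★ `det_le_norm_det_add_I_smul_hermTwo`
import HarnessLib

/-!
# Crux `HLiu418`, ROAD Φ ∕ KIND W organ «Φ6b-ind», (R3) FILE G1: strip bounds for the contour shift in the first chart coordinate

Cell `hodgecm-mathlib`, crux item hLiu418 = `stmt-HodgeConjecture-24832` (helper lane `--supports … --as helper`, count-neutral), route of record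
`HCCMUnconditional`; squad K2 ∕ K2Liu, road `K2_Liu`, socket #41, KIND W.

THE ROAD TO DECAY (organ (R3), growth face of the indefinite archimedean Whittaker letter).  In the chart `x = hermTwo (a, z, b)` the character is
`e(−tr(hx)) = e(−h₀₀a)·e(−(h₀₁z̄ + h₁₀z + h₁₁b))`, so the trace moment `M_e(h; α, β) = ∫ k_Θ(x)^e Φ^h_{α,β}(x) dx` is, fibrewise in `(z, b)`, the
one-dimensional FOURIER TRANSFORM at `ξ = h₀₀` of `a ↦ w(a)`; `w` extends holomorphically to the strip `|im a| < 1` because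
`det(1 − i·hermTwo(a + iτ, z, b)) = det(hermTwo(1+τ, 0, 1) − i·hermTwo(a, z, b))` and `det(1 + i·hermTwo(a + iτ, z, b)) = det(hermTwo(1−τ, 0, 1) + i·hermTwo(a, z, b))`
— determinants of `g ∓ ix` for the two DIAGONAL positive definite `g = diag(1 ± τ, 1)` (principal powers live on the slit plane).  Shifting the line to
`im a = ∓¼` (Paley–Wiener, ★ `Literature.Analysis.Quadrature.norm_fourier_le_exp_mul_integral`, FILE G2) gives the decay `e^{−π|h₀₀|∕2}`.  THIS FILE supplies
the pointwise algebra and the UNIFORM MAJORANT on the strip `|τ| ≤ ½`: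
* §1 `det_diag_add_I_smul`, `det_diag_sub_I_smul`, `norm_det_diag_add_I_smul_sq` — `|det(diag(p,q) + ix)|² = p²q² + q²a² + p²b² + 2pq|z|² + (ab − |z|²)²`
  (a sum of non-negative terms), whence the COMPARISON `norm_det_diag_le_nine_mul` (`|det(diag(p,q)+ix)| ≤ 9|det(diag(p′,q′)+ix)|` for entries in `[½, 3⁄2]`)
  and the lower bounds `mul_le_norm_det_diag` (`pq ≤ |det|`), `mul_abs_le_norm_det_diag` (`q|a| ≤ |det|`);
* §2 `strip_base_sub_eq`, `strip_base_add_eq` — the two bases of the continued integrand at `a + iτ` ARE those determinants;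
* §3 `norm_cpow_pair_le` — `|det(A−ix)^{−α}·det(B+ix)^{−β}| ≤ e^{π(|im α|+|im β|)}·9^{|re α|}·|det(B+ix)|^{−re(α+β)}` (any sign of `re α`),
  `norm_linWeight_le` — the continued weight `|−2πi·(Θ₀₀(a+iτ) + Θ₀₁z̄ + Θ₁₀z + Θ₁₁b)| ≤ 20π·Σ|Θ_jk|·|det(B+ix)|`.
[Shimura1982, §3–§4] (the decay of `ξ(g, h; α, β)` in `h`; here by a contour shift instead of §4's Bessel reduction).
HONEST LABEL.  Count-neutral helper of the K2_Liu road; it pays no socket by itself: `HC_CM` is proved only modulo the 7 printed citations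
(2 remaining named inputs: hLiu418 = `stmt-HodgeConjecture-24832`, h413 = `stmt-HodgeConjecture-24833`) until rung 0 closes.

## References
* [Shimura1982] G. Shimura, *Confluent hypergeometric functions on tube domains*, Math. Ann. 260 (1982) 269–302: §3, §4.
* [Shimura1997] G. Shimura, *Euler Products and Eisenstein Series*, CBMS 93 (1997): §16.4.
-/

set_option autoImplicit false
-- the mandated namespace repeats the single-problem summit's segment (`HodgeConjecture.HodgeConjecture`)
set_option linter.dupNamespace false

noncomputable section

open scoped Matrix ComplexConjugate ComplexOrder
open Complex Matrix MeasureTheory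

namespace Summit.HodgeConjecture.HodgeConjecture.Cruxes.HLiu418.K2LiuHermTwoXiStripBounds

open Summit.HodgeConjecture.HodgeConjecture.Cruxes.HLiu418.K2LiuHermTwoGammaDefs
open Summit.HodgeConjecture.HodgeConjecture.Cruxes.HLiu418.K2LiuHermTwoConfluentXiDefs
open Summit.HodgeConjecture.HodgeConjecture.Cruxes.HLiu418.K2LiuHermTwoDetPowerIntegrable
open Summit.HodgeConjecture.HodgeConjecture.Cruxes.HLiu418.K2LiuHermTwoConfluentXiConvergence (norm_cpow_neg_le)
open Summit.HodgeConjecture.HodgeConjecture.Cruxes.HLiu418.K2LiuHermTwoConfluentXiRegularity (det_le_norm_det_add_I_smul_hermTwo)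
open Summit.HodgeConjecture.HodgeConjecture.Cruxes.HLiu418.K2LiuHermTwoXiCayleyIntegrability (norm_entry_le_mul_norm_det_hermTwo)

/-! ## §1 The diagonal determinants `det(diag(p, q) ± ix)` -/

/-- `det(diag(p,q) + ix) = (p + ia)(q + ib) + |z|²`. [folklore] -/
theorem det_diag_add_I_smul (p q : ℝ) (c : ℝ × ℂ × ℝ) :
    (hermTwo (p, 0, q) + I • hermTwo c).det = ((p : ℂ) + I * (c.1 : ℂ)) * ((q : ℂ) + I * (c.2.2 : ℂ)) + (normSq c.2.1 : ℂ) := by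
  rw [det_add_I_smul_hermTwo, ← mul_conj]
  simp only [hermTwo_apply_zero_zero, hermTwo_apply_zero_one, hermTwo_apply_one_zero, hermTwo_apply_one_one, map_zero]
  linear_combination (-(c.2.1 * conj c.2.1)) * I_sq

/-- `det(diag(p,q) − ix) = (p − ia)(q − ib) + |z|²`. [folklore] -/
theorem det_diag_sub_I_smul (p q : ℝ) (c : ℝ × ℂ × ℝ) :
    (hermTwo (p, 0, q) - I • hermTwo c).det = ((p : ℂ) - I * (c.1 : ℂ)) * ((q : ℂ) - I * (c.2.2 : ℂ)) + (normSq c.2.1 : ℂ) := by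
  rw [det_sub_I_smul_hermTwo, ← mul_conj]
  simp only [hermTwo_apply_zero_zero, hermTwo_apply_zero_one, hermTwo_apply_one_zero, hermTwo_apply_one_one, map_zero]
  linear_combination (-(c.2.1 * conj c.2.1)) * I_sq

/-- **`|det(diag(p,q) + ix)|² = p²q² + q²a² + p²b² + 2pq|z|² + (ab − |z|²)²`** — a sum of non-negative terms for `p, q > 0`. [folklore] -/
theorem norm_det_diag_add_I_smul_sq (p q : ℝ) (c : ℝ × ℂ × ℝ) :
    ‖(hermTwo (p, 0, q) + I • hermTwo c).det‖ ^ 2 =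
      p ^ 2 * q ^ 2 + q ^ 2 * c.1 ^ 2 + p ^ 2 * c.2.2 ^ 2 + 2 * p * q * normSq c.2.1 + (c.1 * c.2.2 - normSq c.2.1) ^ 2 := by
  rw [det_diag_add_I_smul, Complex.sq_norm, Complex.normSq_apply]
  simp only [add_re, add_im, mul_re, mul_im, ofReal_re, ofReal_im, I_re, I_im, zero_mul, one_mul, mul_zero, sub_zero, zero_add,
    add_zero]
  ring

/-- `|det(diag(p,q) − ix)| = |det(diag(p,q) + ix)|` (`p, q > 0`). [folklore] -/
theorem norm_det_diag_sub_eq {p q : ℝ} (hp : 0 < p) (hq : 0 < q) (c : ℝ × ℂ × ℝ) :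
    ‖(hermTwo (p, 0, q) - I • hermTwo c).det‖ = ‖(hermTwo (p, 0, q) + I • hermTwo c).det‖ := by
  have hd : (hermTwo (p, (0 : ℂ), q)).PosDef := (posDef_hermTwo_iff _).mpr ⟨hp, by simpa using mul_pos hp hq⟩
  rw [det_sub_I_smul_eq_conj hd, Complex.norm_conj]

/-- For `x ∈ [½, 3⁄2]` and `y ∈ [½, 3⁄2]`: `x² ≤ 9y²`. [folklore] -/
theorem sq_le_nine_mul_sq {x y : ℝ} (hx : x ≤ 3 / 2) (hx0 : 0 ≤ x) (hy : 1 / 2 ≤ y) : x ^ 2 ≤ 9 * y ^ 2 := by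
  have h : x ≤ 3 * y := by linarith
  nlinarith

/-- **COMPARISON OF THE TWO DIAGONAL «g»'s**: for diagonal entries in `[½, 3⁄2]`, `|det(diag(p,q) + ix)| ≤ 9·|det(diag(p′,q′) + ix)|`. [folklore] -/
theorem norm_det_diag_le_nine_mul {p q p' q' : ℝ} (hp : 1 / 2 ≤ p) (hp1 : p ≤ 3 / 2) (hq : 1 / 2 ≤ q) (hq1 : q ≤ 3 / 2)
    (hp' : 1 / 2 ≤ p') (hq' : 1 / 2 ≤ q') (c : ℝ × ℂ × ℝ) :
    ‖(hermTwo (p, 0, q) + I • hermTwo c).det‖ ≤ 9 * ‖(hermTwo (p', 0, q') + I • hermTwo c).det‖ := by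
  have hpp := sq_le_nine_mul_sq hp1 (by linarith) hp'
  have hqq := sq_le_nine_mul_sq hq1 (by linarith) hq'
  have hr : 0 ≤ normSq c.2.1 := normSq_nonneg _
  have ha : 0 ≤ c.1 ^ 2 := sq_nonneg _
  have hb : 0 ≤ c.2.2 ^ 2 := sq_nonneg _
  have hs : 0 ≤ (c.1 * c.2.2 - normSq c.2.1) ^ 2 := sq_nonneg _
  have hpq : p * q ≤ 9 * (p' * q') := by nlinarith
  have t1 : p ^ 2 * q ^ 2 ≤ 81 * (p' ^ 2 * q' ^ 2) := by nlinarith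
  have t2 : q ^ 2 * c.1 ^ 2 ≤ 81 * (q' ^ 2 * c.1 ^ 2) := by nlinarith
  have t3 : p ^ 2 * c.2.2 ^ 2 ≤ 81 * (p' ^ 2 * c.2.2 ^ 2) := by nlinarith
  have t4 : 2 * p * q * normSq c.2.1 ≤ 81 * (2 * p' * q' * normSq c.2.1) := by
    have h1 := mul_le_mul_of_nonneg_right hpq hr
    have h2 : 0 ≤ p' * q' * normSq c.2.1 := mul_nonneg (mul_nonneg (by linarith) (by linarith)) hr
    nlinarith
  have key : ‖(hermTwo (p, 0, q) + I • hermTwo c).det‖ ^ 2 ≤ (9 * ‖(hermTwo (p', 0, q') + I • hermTwo c).det‖) ^ 2 := by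
    rw [mul_pow, norm_det_diag_add_I_smul_sq, norm_det_diag_add_I_smul_sq]
    nlinarith
  exact (pow_le_pow_iff_left₀ (norm_nonneg _) (by positivity) two_ne_zero).mp key

/-- `pq ≤ |det(diag(p,q) + ix)|` for `p, q > 0`; in particular `¼ ≤ |det|` on `[½, 3⁄2]`. [folklore] -/
theorem mul_le_norm_det_diag {p q : ℝ} (hp : 0 < p) (hq : 0 < q) (c : ℝ × ℂ × ℝ) :
    p * q ≤ ‖(hermTwo (p, 0, q) + I • hermTwo c).det‖ := by
  have h := det_le_norm_det_add_I_smul_hermTwo (p, (0 : ℂ), q) ⟨hp, by simpa using mul_pos hp hq⟩ c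
  simpa using h

/-- `q·|a| ≤ |det(diag(p,q) + ix)|` (from §1's sum of squares), `p, q > 0`. [folklore] -/
theorem mul_abs_le_norm_det_diag {p q : ℝ} (hp : 0 < p) (hq : 0 < q) (c : ℝ × ℂ × ℝ) :
    q * |c.1| ≤ ‖(hermTwo (p, 0, q) + I • hermTwo c).det‖ := by
  have key : (q * |c.1|) ^ 2 ≤ ‖(hermTwo (p, 0, q) + I • hermTwo c).det‖ ^ 2 := by
    rw [norm_det_diag_add_I_smul_sq, mul_pow, sq_abs]
    nlinarith [sq_nonneg (p * q), sq_nonneg (p * c.2.2), mul_pos hp hq, normSq_nonneg c.2.1, sq_nonneg (c.1 * c.2.2 - normSq c.2.1)]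
  exact (pow_le_pow_iff_left₀ (by positivity) (norm_nonneg _) two_ne_zero).mp key

/-! ## §2 The two bases of the continued integrand at `a + iτ` -/

/-- **FIRST BASE**: `(1 − i(a+iτ))(1 − ib) + |z|² = det(diag(1+τ, 1) − i·hermTwo(a,z,b))`. [folklore] -/
theorem strip_base_sub_eq (τ a b : ℝ) (z : ℂ) :
    (1 - I * ((a : ℂ) + (τ : ℂ) * I)) * (1 - I * (b : ℂ)) + z * conj z = (hermTwo (1 + τ, 0, 1) - I • hermTwo (a, z, b)).det := by
  rw [det_diag_sub_I_smul, ← mul_conj]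
  push_cast
  linear_combination (-((τ : ℂ) * (1 - I * (b : ℂ)))) * I_sq

/-- **SECOND BASE**: `(1 + i(a+iτ))(1 + ib) + |z|² = det(diag(1−τ, 1) + i·hermTwo(a,z,b))`. [folklore] -/
theorem strip_base_add_eq (τ a b : ℝ) (z : ℂ) :
    (1 + I * ((a : ℂ) + (τ : ℂ) * I)) * (1 + I * (b : ℂ)) + z * conj z = (hermTwo (1 - τ, 0, 1) + I • hermTwo (a, z, b)).det := by
  rw [det_diag_add_I_smul, ← mul_conj]
  push_cast
  linear_combination ((τ : ℂ) * (1 + I * (b : ℂ))) * I_sq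

/-- At `τ = 0` the first base is `det(1 − i·hermTwo(a,z,b))`. [folklore] -/
theorem base_sub_eq_det_one (a b : ℝ) (z : ℂ) :
    (1 - I * (a : ℂ)) * (1 - I * (b : ℂ)) + z * conj z = ((1 : Matrix (Fin 2) (Fin 2) ℂ) - I • hermTwo (a, z, b)).det := by
  have h := strip_base_sub_eq 0 a b z
  simp only [ofReal_zero, zero_mul, add_zero] at h
  rw [h]
  congr 2
  ext i j
  fin_cases i <;> fin_cases j <;> simp [hermTwo]

/-- At `τ = 0` the second base is `det(1 + i·hermTwo(a,z,b))`. [folklore] -/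
theorem base_add_eq_det_one (a b : ℝ) (z : ℂ) :
    (1 + I * (a : ℂ)) * (1 + I * (b : ℂ)) + z * conj z = ((1 : Matrix (Fin 2) (Fin 2) ℂ) + I • hermTwo (a, z, b)).det := by
  have h := strip_base_add_eq 0 a b z
  simp only [ofReal_zero, zero_mul, add_zero, sub_zero] at h
  rw [h]
  congr 2
  ext i j
  fin_cases i <;> fin_cases j <;> simp [hermTwo]

/-! ## §3 The uniform majorant on the strip `|τ| ≤ ½` -/

/-- `x^{−r} ≤ 9^{|r|}·y^{−r}` whenever `y∕9 ≤ x ≤ 9y` among positive reals (any sign of `r`). [folklore] -/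
theorem rpow_neg_le_of_comparable {x y r : ℝ} (hx : 0 < x) (hy : 0 < y) (h1 : x ≤ 9 * y) (h2 : y ≤ 9 * x) :
    x ^ (-r) ≤ (9 : ℝ) ^ |r| * y ^ (-r) := by
  rcases le_or_gt 0 r with hr | hr
  · -- `r ≥ 0`: use `y/9 ≤ x`
    have h3 : y / 9 ≤ x := by linarith
    calc x ^ (-r) ≤ (y / 9) ^ (-r) := Real.rpow_le_rpow_of_nonpos (by positivity) h3 (by linarith)
      _ = (9 : ℝ) ^ r * y ^ (-r) := by
          rw [Real.div_rpow hy.le (by norm_num), Real.rpow_neg (by norm_num : (0 : ℝ) ≤ 9), div_eq_mul_inv, inv_inv, mul_comm]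
      _ = (9 : ℝ) ^ |r| * y ^ (-r) := by rw [abs_of_nonneg hr]
  · -- `r < 0`: use `x ≤ 9y`
    calc x ^ (-r) ≤ (9 * y) ^ (-r) := Real.rpow_le_rpow hx.le h1 (by linarith)
      _ = (9 : ℝ) ^ (-r) * y ^ (-r) := Real.mul_rpow (by norm_num) hy.le
      _ = (9 : ℝ) ^ |r| * y ^ (-r) := by rw [abs_of_neg hr]

/-- **THE TWO PRINCIPAL POWERS ON THE STRIP**: for diagonal `A = diag(p,q)`, `B = diag(p′,q′)` with entries in `[½, 3⁄2]`,
`|det(A − ix)^{−α}·det(B + ix)^{−β}| ≤ e^{π(|im α|+|im β|)}·9^{|re α|}·|det(B + ix)|^{−re(α+β)}`. [folklore] -/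
theorem norm_cpow_pair_le {p q p' q' : ℝ} (hp : 1 / 2 ≤ p) (hp1 : p ≤ 3 / 2) (hq : 1 / 2 ≤ q) (hq1 : q ≤ 3 / 2)
    (hp' : 1 / 2 ≤ p') (hp'1 : p' ≤ 3 / 2) (hq' : 1 / 2 ≤ q') (hq'1 : q' ≤ 3 / 2) (α β : ℂ) (c : ℝ × ℂ × ℝ) :
    ‖(hermTwo (p, 0, q) - I • hermTwo c).det ^ (-α) * (hermTwo (p', 0, q') + I • hermTwo c).det ^ (-β)‖ ≤
      Real.exp (Real.pi * (|α.im| + |β.im|)) * (9 : ℝ) ^ |α.re| * ‖(hermTwo (p', 0, q') + I • hermTwo c).det‖ ^ (-(α + β).re) := by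
  have hp0 : 0 < p := by linarith
  have hq0 : 0 < q := by linarith
  have hp'0 : 0 < p' := by linarith
  have hq'0 : 0 < q' := by linarith
  have hApos : 0 < ‖(hermTwo (p, 0, q) - I • hermTwo c).det‖ := by
    rw [norm_det_diag_sub_eq hp0 hq0]; exact lt_of_lt_of_le (mul_pos hp0 hq0) (mul_le_norm_det_diag hp0 hq0 c)
  have hBpos : 0 < ‖(hermTwo (p', 0, q') + I • hermTwo c).det‖ := lt_of_lt_of_le (mul_pos hp'0 hq'0) (mul_le_norm_det_diag hp'0 hq'0 c)
  have hA := norm_cpow_neg_le (norm_pos_iff.mp hApos) α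
  have hB := norm_cpow_neg_le (norm_pos_iff.mp hBpos) β
  -- compare `|det(A − ix)|` with `|det(B + ix)|`
  have h1 : ‖(hermTwo (p, 0, q) - I • hermTwo c).det‖ ≤ 9 * ‖(hermTwo (p', 0, q') + I • hermTwo c).det‖ := by
    rw [norm_det_diag_sub_eq hp0 hq0]; exact norm_det_diag_le_nine_mul hp hp1 hq hq1 hp' hq' c
  have h2 : ‖(hermTwo (p', 0, q') + I • hermTwo c).det‖ ≤ 9 * ‖(hermTwo (p, 0, q) - I • hermTwo c).det‖ := by
    rw [norm_det_diag_sub_eq hp0 hq0]; exact norm_det_diag_le_nine_mul hp' hp'1 hq' hq'1 hp hq c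
  have hcmp := rpow_neg_le_of_comparable (r := α.re) hApos hBpos h1 h2
  have hexp : Real.exp (Real.pi * |α.im|) * Real.exp (Real.pi * |β.im|) = Real.exp (Real.pi * (|α.im| + |β.im|)) := by
    rw [← Real.exp_add]; ring_nf
  have hpow : ‖(hermTwo (p', 0, q') + I • hermTwo c).det‖ ^ (-α.re) * ‖(hermTwo (p', 0, q') + I • hermTwo c).det‖ ^ (-β.re) =
      ‖(hermTwo (p', 0, q') + I • hermTwo c).det‖ ^ (-(α + β).re) := by
    rw [← Real.rpow_add hBpos, add_re]; ring_nf
  rw [norm_mul]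
  calc ‖(hermTwo (p, 0, q) - I • hermTwo c).det ^ (-α)‖ * ‖(hermTwo (p', 0, q') + I • hermTwo c).det ^ (-β)‖
      ≤ (Real.exp (Real.pi * |α.im|) * ((9 : ℝ) ^ |α.re| * ‖(hermTwo (p', 0, q') + I • hermTwo c).det‖ ^ (-α.re))) *
          (Real.exp (Real.pi * |β.im|) * ‖(hermTwo (p', 0, q') + I • hermTwo c).det‖ ^ (-β.re)) := by
        refine mul_le_mul (hA.trans (mul_le_mul_of_nonneg_left hcmp (Real.exp_pos _).le)) hB (norm_nonneg _) (by positivity)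
    _ = Real.exp (Real.pi * (|α.im| + |β.im|)) * (9 : ℝ) ^ |α.re| * ‖(hermTwo (p', 0, q') + I • hermTwo c).det‖ ^ (-(α + β).re) := by
        rw [← hexp, ← hpow]; ring

/-- **THE CONTINUED WEIGHT ON THE STRIP**: for `|τ| ≤ ½`, `|−2πi·(Θ₀₀(a + iτ) + Θ₀₁z̄ + Θ₁₀z + Θ₁₁b)| ≤ 20π·(Σ_jk |Θ_jk|)·|det(diag(1−τ,1) + i·hermTwo(a,z,b))|`
(entries are dominated by the determinant, ★ `norm_entry_le_mul_norm_det_hermTwo`; `det(diag(1−τ,1)) ≥ ½`). [folklore] -/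
theorem norm_linWeight_le (Θ : Matrix (Fin 2) (Fin 2) ℂ) {τ : ℝ} (hτ : |τ| ≤ 1 / 2) (a b : ℝ) (z : ℂ) :
    ‖-(2 * Real.pi * I) * (Θ 0 0 * ((a : ℂ) + (τ : ℂ) * I) + Θ 0 1 * conj z + Θ 1 0 * z + Θ 1 1 * (b : ℂ))‖ ≤
      20 * Real.pi * (‖Θ 0 0‖ + ‖Θ 0 1‖ + ‖Θ 1 0‖ + ‖Θ 1 1‖) * ‖(hermTwo (1 - τ, 0, 1) + I • hermTwo (a, z, b)).det‖ := by
  have hτ1 : 1 / 2 ≤ 1 - τ := by linarith [(abs_le.mp hτ).2]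
  have hτ2 : 1 - τ ≤ 3 / 2 := by linarith [(abs_le.mp hτ).1]
  set D : ℝ := ‖(hermTwo (1 - τ, 0, 1) + I • hermTwo (a, z, b)).det‖ with hD
  -- the determinant dominates `1` and the entries
  have hd : 0 < (1 - τ, (0 : ℂ), (1 : ℝ)).1 ∧ normSq (1 - τ, (0 : ℂ), (1 : ℝ)).2.1 < (1 - τ, (0 : ℂ), (1 : ℝ)).1 * (1 - τ, (0 : ℂ), (1 : ℝ)).2.2 := by
    refine ⟨by simp only; linarith, ?_⟩
    simp only [map_zero, mul_one]
    linarith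
  have hDhalf : 1 / 2 ≤ D := by
    have := mul_le_norm_det_diag (p := 1 - τ) (q := 1) (by linarith) one_pos (a, z, b)
    rw [hD]; linarith
  have hsubnorm : ‖(hermTwo (1 - τ, 0, 1) - I • hermTwo (a, z, b)).det‖ = D := norm_det_diag_sub_eq (by linarith) one_pos _
  have hK : (1 - τ + 1) / ((1 - τ) * 1 - normSq (0 : ℂ)) ≤ 3 := by
    rw [map_zero, sub_zero, mul_one, div_le_iff₀ (by linarith)]
    linarith
  have hent : ∀ i j : Fin 2, ‖(hermTwo (1 - τ, 0, 1) - I • hermTwo (a, z, b)) i j‖ ≤ 3 * D := by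
    intro i j
    have h := norm_entry_le_mul_norm_det_hermTwo (1 - τ, (0 : ℂ), (1 : ℝ)) hd (a, z, b) i j
    rw [hsubnorm] at h
    exact h.trans (mul_le_mul_of_nonneg_right hK (by linarith))
  -- the three chart coordinates against `D`
  have ha : ‖(a : ℂ)‖ ≤ 3 * D + 3 / 2 := by
    have h00 := hent 0 0
    simp only [Matrix.sub_apply, Matrix.smul_apply, smul_eq_mul, hermTwo_apply_zero_zero] at h00
    -- entry `(0,0) = (1 − τ) − i a`
    have key : ‖(a : ℂ)‖ ≤ ‖(((1 - τ : ℝ) : ℂ))‖ + ‖(((1 - τ : ℝ) : ℂ)) - I * (a : ℂ)‖ := by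
      calc ‖(a : ℂ)‖ = ‖I * (a : ℂ)‖ := by rw [norm_mul, Complex.norm_I, one_mul]
        _ = ‖(((1 - τ : ℝ) : ℂ)) - ((((1 - τ : ℝ) : ℂ)) - I * (a : ℂ))‖ := by congr 1; ring
        _ ≤ ‖(((1 - τ : ℝ) : ℂ))‖ + ‖(((1 - τ : ℝ) : ℂ)) - I * (a : ℂ)‖ := norm_sub_le _ _
    have hn : ‖(((1 - τ : ℝ) : ℂ))‖ ≤ 3 / 2 := by
      rw [Complex.norm_real, Real.norm_eq_abs, abs_of_pos (by linarith)]; exact hτ2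
    push_cast at key h00 hn ⊢
    linarith
  have hz : ‖z‖ ≤ 3 * D := by
    have h01 := hent 0 1
    simp only [Matrix.sub_apply, Matrix.smul_apply, smul_eq_mul, hermTwo_apply_zero_one] at h01
    simpa [norm_mul, Complex.norm_I] using h01
  have hb : ‖(b : ℂ)‖ ≤ 3 * D + 1 := by
    have h11 := hent 1 1
    simp only [Matrix.sub_apply, Matrix.smul_apply, smul_eq_mul, hermTwo_apply_one_one] at h11
    have key : ‖(b : ℂ)‖ ≤ ‖(1 : ℂ)‖ + ‖(1 : ℂ) - I * (b : ℂ)‖ := by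
      calc ‖(b : ℂ)‖ = ‖I * (b : ℂ)‖ := by rw [norm_mul, Complex.norm_I, one_mul]
        _ = ‖(1 : ℂ) - ((1 : ℂ) - I * (b : ℂ))‖ := by congr 1; ring
        _ ≤ ‖(1 : ℂ)‖ + ‖(1 : ℂ) - I * (b : ℂ)‖ := norm_sub_le _ _
    rw [norm_one] at key
    push_cast at key h11 ⊢
    linarith
  -- assemble
  have hS0 : 0 ≤ ‖Θ 0 0‖ + ‖Θ 0 1‖ + ‖Θ 1 0‖ + ‖Θ 1 1‖ := by positivity
  have hlin : ‖Θ 0 0 * ((a : ℂ) + (τ : ℂ) * I) + Θ 0 1 * conj z + Θ 1 0 * z + Θ 1 1 * (b : ℂ)‖ ≤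
      (‖Θ 0 0‖ + ‖Θ 0 1‖ + ‖Θ 1 0‖ + ‖Θ 1 1‖) * (10 * D) := by
    have hζ : ‖(a : ℂ) + (τ : ℂ) * I‖ ≤ 10 * D := by
      calc ‖(a : ℂ) + (τ : ℂ) * I‖ ≤ ‖(a : ℂ)‖ + ‖(τ : ℂ) * I‖ := norm_add_le _ _
        _ = ‖(a : ℂ)‖ + |τ| := by rw [norm_mul, Complex.norm_I, mul_one, Complex.norm_real τ, Real.norm_eq_abs]
        _ ≤ 10 * D := by linarith
    have hz' : ‖conj z‖ ≤ 10 * D := by rw [Complex.norm_conj]; linarith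
    have hz'' : ‖z‖ ≤ 10 * D := by linarith
    have hb' : ‖(b : ℂ)‖ ≤ 10 * D := by linarith
    have e4 : ∀ u v w x : ℂ, ‖u + v + w + x‖ ≤ ‖u‖ + ‖v‖ + ‖w‖ + ‖x‖ := fun u v w x => by
      calc ‖u + v + w + x‖ ≤ ‖u + v + w‖ + ‖x‖ := norm_add_le _ _
        _ ≤ ‖u + v‖ + ‖w‖ + ‖x‖ := by gcongr; exact norm_add_le _ _
        _ ≤ ‖u‖ + ‖v‖ + ‖w‖ + ‖x‖ := by gcongr; exact norm_add_le _ _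
    calc ‖Θ 0 0 * ((a : ℂ) + (τ : ℂ) * I) + Θ 0 1 * conj z + Θ 1 0 * z + Θ 1 1 * (b : ℂ)‖
        ≤ ‖Θ 0 0 * ((a : ℂ) + (τ : ℂ) * I)‖ + ‖Θ 0 1 * conj z‖ + ‖Θ 1 0 * z‖ + ‖Θ 1 1 * (b : ℂ)‖ := e4 _ _ _ _
      _ = ‖Θ 0 0‖ * ‖(a : ℂ) + (τ : ℂ) * I‖ + ‖Θ 0 1‖ * ‖conj z‖ + ‖Θ 1 0‖ * ‖z‖ + ‖Θ 1 1‖ * ‖(b : ℂ)‖ := by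
          simp only [norm_mul]
      _ ≤ ‖Θ 0 0‖ * (10 * D) + ‖Θ 0 1‖ * (10 * D) + ‖Θ 1 0‖ * (10 * D) + ‖Θ 1 1‖ * (10 * D) := by
          gcongr
      _ = (‖Θ 0 0‖ + ‖Θ 0 1‖ + ‖Θ 1 0‖ + ‖Θ 1 1‖) * (10 * D) := by ring
  have h2π : ‖-(2 * Real.pi * I : ℂ)‖ = 2 * Real.pi := by
    rw [norm_neg, norm_mul, norm_mul, Complex.norm_I, mul_one, Complex.norm_real, RCLike.norm_ofNat, Real.norm_eq_abs,
      abs_of_pos Real.pi_pos]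
  rw [norm_mul, h2π]
  calc 2 * Real.pi * ‖Θ 0 0 * ((a : ℂ) + (τ : ℂ) * I) + Θ 0 1 * conj z + Θ 1 0 * z + Θ 1 1 * (b : ℂ)‖
      ≤ 2 * Real.pi * ((‖Θ 0 0‖ + ‖Θ 0 1‖ + ‖Θ 1 0‖ + ‖Θ 1 1‖) * (10 * D)) := mul_le_mul_of_nonneg_left hlin (by positivity)
    _ = 20 * Real.pi * (‖Θ 0 0‖ + ‖Θ 0 1‖ + ‖Θ 1 0‖ + ‖Θ 1 1‖) * D := by ring

end Summit.HodgeConjecture.HodgeConjecture.Cruxes.HLiu418.K2LiuHermTwoXiStripBounds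

end
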